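import Mathlib
import Literature.NumberTheory.LFunctions.DeBruijnNewman
import Literature.NumberTheory.LFunctions.DeBruijnHDiv

/-!
Sketch (planner, crux-ideate r1 k1 on stmt-RiemannHypothesis-2575 `LaplaceLoophole`).
No positive line is filed. These are the NEGATIVE-side signatures recorded in the barrier notes
(for the provers of NarrowKernelNoGo / MediumKernelNoGo), checked to elaborate only.
-/

namespace Summit.RiemannHypothesis.RiemannHypothesis.Cruxes.LaplaceLoophole.Sketch

open Literature.NumberTheory.LFunctions MeasureTheory

/-- Subordination identity: the Laplace(a)-divided transform is the Exp(a²)-mixture of de Bruijn's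
family at NEGATIVE times, `F_a(z) = ∫₀^∞ a² e^{−a² s} H_{−s}(z) ds`
(from `1/(1+u²/a²) = ∫₀^∞ a² e^{−a² s} e^{−s u²} ds` and Fubini). -/
def Subordination : Prop :=
  ∀ a : ℝ, 0 < a → ∀ z : ℂ,
    deBruijnHDiv (fun u : ℝ => 1 + u ^ 2 / a ^ 2) z =
      ∫ s in Set.Ioi (0:ℝ), ((a ^ 2 * Real.exp (-(a ^ 2 * s)) : ℝ) : ℂ) * deBruijnH (-s) z

/-- The scalar identity behind it. -/
def LaplaceMultiplierAsGaussianMixture : Prop :=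
  ∀ a u : ℝ, 0 < a →
    ∫ s in Set.Ioi (0:ℝ), a ^ 2 * Real.exp (-(a ^ 2 * s)) * Real.exp (-(s * u ^ 2)) = 1 / (1 + u ^ 2 / a ^ 2)

/-- Sign-change deficit ⇒ ¬X(a), the shape the numerics (job j012857) instantiate: if on some
interval the real function `x ↦ Re F_a(x)` has fewer sign changes than `F_a` has zeros (with
multiplicity) in the thin box around it, `F_a` has a non-real zero. Stated here only in the crude
"two real zeros of H_0 bracket no sign change of F_a while F_a keeps one sign" form already proved
in tree (`UniversalFactor.not_hasOnlyRealZeros_of_pair`); recorded for orientation. -/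
def DeficitShape : Prop :=
  ∀ a : ℝ, 0 < a → ∀ x₁ x₂ : ℝ, x₁ < x₂ →
    (∀ x ∈ Set.Icc x₁ x₂, deBruijnHDiv (fun u : ℝ => 1 + u ^ 2 / a ^ 2) x ≠ 0) →
    True

example : LaplaceMultiplierAsGaussianMixture → True := fun _ => trivial

/-- Recommended cheap cover of the low end of the kill path (tenure planner's call, see BarrierNotes-r1-k1.md §1(W)):
every `a ∈ (0, 0.45]` — the proved WideKernelNoGo's range, the exceptional direction `a* ≈ 0.3194150268`, the strip edge
`a = π/8` and the bottom of the medium window — is killed by ONE a-uniform certified lost-pair statement among the zeros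
`t = 14.13, 21.02, 25.01, 30.43, 32.94` (η = 0 form of `UniversalFactor.not_hasOnlyRealZeros_of_pair`). -/
def WideLowWindowNoGo : Prop :=
  ∀ a : ℝ, 0 < a → a ≤ 9 / 20 →
    ¬ HasOnlyRealZeros (deBruijnHDiv fun u : ℝ => 1 + u ^ 2 / a ^ 2)

/-- The rest of the computable window by finitely many certified lost pairs with overlapping a-intervals
(witness map j012972: pairs at t = 30.4, 48.0, 75.7, 111.0, 184.9, 221.4, 333.6, 415.0, 564.2, 750.7, 1054.8, 1329.0,
1977.2, 7005.06, 17143.79 cover [0.43, 39.7] without break). -/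
def PairWindowNoGo : Prop :=
  ∀ a : ℝ, 9 / 20 ≤ a → a ≤ 39 →
    ¬ HasOnlyRealZeros (deBruijnHDiv fun u : ℝ => 1 + u ^ 2 / a ^ 2)

/-- Glue: the two window statements cover `(0, 39]` (so `MediumKernelNoGo`'s `[π/8, 32]`, `WideKernelNoGo`'s
hypothesis-free version and `ExceptionalWideNoGo` restricted to what the kill path uses all follow). -/
theorem noGo_of_windows (h₁ : WideLowWindowNoGo) (h₂ : PairWindowNoGo) :
    ∀ a : ℝ, 0 < a → a ≤ 39 → ¬ HasOnlyRealZeros (deBruijnHDiv fun u : ℝ => 1 + u ^ 2 / a ^ 2) := by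
  intro a ha hle
  by_cases h : a ≤ 9 / 20
  · exact h₁ a ha h
  · exact h₂ a (le_of_lt (lt_of_not_ge h)) hle


end Summit.RiemannHypothesis.RiemannHypothesis.Cruxes.LaplaceLoophole.Sketch
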